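import Literature.NumberTheory.NumberFields.HilbertClassFieldIdelicCapitulation
import Literature.NumberTheory.AdelicBaseChange.IdeleConormIdeals
import Literature.NumberTheory.AdelicBaseChange.AutomorphicCompat
import HarnessLib

/-!
# Idelic capitulation in ANY `E`-isomorphic copy of the Hilbert class field, via `[(con x)_f] = i_{M|E}[(x_f)]`
# (Cassels II §19: «con … compatible … on taking principal ideals»; Neukirch VI (7.5), III (1.6) (i))

Topic `NumberTheory/NumberFields`; namespace `Literature.NumberTheory.NumberFields` (statements about the Hilbert class
field in `….hilbertClassField`).  THEOREMS ONLY (no definition, no named fact, no `sorry`, no instance); unconditional.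
Sequel of `HilbertClassFieldIdelicCapitulation.lean` (brick (A3c-1) of lane «PT3-TC», cell `bsd-eis`, crux 2
stmt-BirchSwinnertonDyer-19032; lane owner bsd-line-x1-p1-w8 g9; this brick (A3c-3a) by width seat -w6 g8).

WHY.  The lane's colimit runs over the finite Galois layers `E ⊆ K̄ = AlgebraicClosure K` inside `K_S`
(`IdeleClassBar.GalLayer K` with `N_S ≤ Gal(K̄/E)`); the capitulating layer must be such a layer `M ⊇ E` INSIDE `K̄`,
whereas the tree's Hilbert class field `hilbertClassField E` lives in `AlgebraicClosure E`.  So the capitulation has to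
be read on an `E`-isomorphic copy `e : hilbertClassField E ≃ₐ[E] M`.  This file does that without transporting idèles:

* §1 **`ideleIdealClass_baseChange`** — «`[(con x)_f] = i_{L|K}[(x_f)]`» in `Cl(L)` for EVERY idèle `x` of `K` and every
  finite extension `L/K` (the tree's `AdelicBaseChange.toIdealUnits_finiteIdeleConorm` — Cassels's «on passing to the
  quotient from `J_k` we have the induced map `con : I_k → I_K`», which IS `𝔞 ↦ 𝔞𝓞_L` — read through `x ↦ [(x_f)]`);
* §2 for an `E`-algebra `M` with `e : hilbertClassField E ≃ₐ[E] M`: `classGroupExtend E M = 1`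
  (`i_{M|E} = i_{M|H(E)} ∘ i_{H(E)|E}`, Neukirch III (1.6) (i), and the principal ideal theorem `i_{H(E)|E} = 1`), hence
  **`baseChange_mem_principalIdeles_sup_unitIdeles_of_algEquiv`** (`con_{M/E} x ∈ Mˣ · 𝕌_M`) and the `S`-idèle forms
  `…_sup_ideleS_of_algEquiv`, **`exists_principal_mul_ideleS_eq_ideleBaseChange_of_algEquiv`** (the shape
  `∃ u : Mˣ, ∃ j ∈ J_{M,S}, ideleBaseChange E M x = principal M u * j` consumed by the (A3d) chase, stated for the tree's
  `Automorphic.AdeleRing.ideleBaseChange`, bridged by `AutomorphicCompat.adeleRing_baseChange_toRingHom_eq`);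
* §3 transports along `e`: `finiteDimensional_of_algEquiv`, **`isUnramifiedIn_of_algEquiv`** (every finite place of `E`
  is unramified in `M`: ramification indices over `ℤ` are invariant under the ring isomorphism `𝓞 H(E) ≅ 𝓞 M`, and `e` is
  multiplicative in towers — adapted from the tree's private `forall_isUnramifiedIn_of_ringEquiv_twist`,
  `HilbertClassFieldOfGaloisExtension.lean`, with the twist `σ = 1`), **`isGalois_of_algEquiv`** (`M/F` Galois when `E/F`
  is, `hilbertClassField.isGalois_of_isGalois`).

HONEST FRAMING: bookkeeping over landed theorems; no statement of any Summit is proved; BSD is not advanced by this file.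

## References
* J. W. S. Cassels, A. Fröhlich (eds.), *Algebraic Number Theory* (1967), Ch. II (Cassels) §19 (conorm of idèles vs
  ideals, «compatible … on taking principal ideals»). [CasselsFrohlichANT1967]
* J. Neukirch, *Algebraic Number Theory* (1999), Ch. III §1 Prop. (1.6) (i),(v); Ch. VI §1 Prop. (1.9), (1.11); §7
  Thm. (7.5). [NeukirchANT1999]
* L. C. Washington, *Introduction to Cyclotomic Fields*, 2nd ed. (1997), Thm. 10.4 (proof: `H(L)/K` Galois). [Washington1997]
-/

noncomputable section

open NumberField IsDedekindDomain

namespace Literature.NumberTheory.NumberFields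

open Literature.NumberTheory.GaloisRepresentations Literature.NumberTheory.AdelicBaseChange

/-! ## §1. `[(con x)_f] = i_{L|K}[(x_f)]` -/

/-- **The ideal class of the conorm of an idèle is the extension of its ideal class**: for number fields `K ⊆ L` and
every idèle `x` of `K`, `[(con_{L/K} x)_f] = i_{L|K}[(x_f)]` in `Cl(L)` — Cassels's induced conorm on ideal groups IS
`𝔞 ↦ 𝔞𝓞_L` (tree `toIdealUnits_finiteIdeleConorm`), read through `x ↦ [(x_f)]` (`ideleIdealClass`) and
`[𝔞] ↦ [𝔞𝓞_L]` (`classGroupExtend`). [cite: CasselsFrohlichANT1967, Ch. II §19 («the induced maps con_{K/k} : I_k → I_K … compatible … on taking principal ideals»)]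
[cite: NeukirchANT1999, Ch. VI §1 Prop. (1.9); Ch. III §1 Prop. (1.6)] -/
theorem ideleIdealClass_baseChange (K L : Type) [Field K] [NumberField K] [Field L] [NumberField L] [Algebra K L]
    (x : ideleGroup K) :
    ideleIdealClass L (Units.map (NumberField.AdeleRing.baseChange K L :
      AdeleRing (𝓞 K) K →* AdeleRing (𝓞 L) L) x) = classGroupExtend K L (ideleIdealClass K x) := by
  rw [ideleIdealClass_apply, ideleIdealClass_apply, classGroupExtend_mk]
  congr 1
  have h := toIdealUnits_finiteIdeleConorm K L (IdeleAction.finitePart K x)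
  rw [← finitePart_ideleConorm] at h
  exact h

/-! ## §2. Capitulation in an `E`-isomorphic copy of `H(E)` -/

namespace hilbertClassField

variable (E : Type) [Field E] [NumberField E] (M : Type) [Field M] [NumberField M] [Algebra E M]

/-- **`i_{M|E} = 1` on `Cl(E)` for any `E`-isomorphic copy `M` of the Hilbert class field**: with the `H(E)`-algebra
structure `e` on `M`, `i_{M|E} = i_{M|H(E)} ∘ i_{H(E)|E}` (Neukirch III (1.6) (i)) and `i_{H(E)|E} = 1` (principal ideal
theorem). [cite: NeukirchANT1999, Ch. VI §7 Thm. (7.5); Ch. III §1 Prop. (1.6) (i)] -/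
theorem classGroupExtend_eq_one_of_algEquiv (e : hilbertClassField E ≃ₐ[E] M) (c : ClassGroup (𝓞 E)) :
    classGroupExtend E M c = 1 := by
  letI : Algebra (hilbertClassField E) M := (e : hilbertClassField E →+* M).toAlgebra
  haveI : IsScalarTower E (hilbertClassField E) M := IsScalarTower.of_algebraMap_eq fun a =>
    (e.commutes a).symm
  rw [← classGroupExtend_classGroupExtend (K := E) (hilbertClassField E) M c, classGroupExtend_eq_one, map_one]

/-- **Idelic principal ideal theorem in a copy**: for `e : H(E) ≃ₐ[E] M` and every idèle `x` of `E`,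
`con_{M/E} x ∈ Mˣ · 𝕌_M` (`[(con x)_f] = i_{M|E}[(x_f)] = 1`, then `ker (x ↦ [(x_f)]) = Mˣ · W_1 ≤ Mˣ · 𝕌`).
[cite: NeukirchANT1999, Ch. VI §7 Thm. (7.5); §1 Prop. (1.11)] [cite: CasselsFrohlichANT1967, Ch. II §19] -/
theorem baseChange_mem_principalIdeles_sup_unitIdeles_of_algEquiv (e : hilbertClassField E ≃ₐ[E] M)
    (x : ideleGroup E) :
    Units.map (NumberField.AdeleRing.baseChange E M : AdeleRing (𝓞 E) E →* AdeleRing (𝓞 M) M) x ∈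
      principalIdeles M ⊔ unitIdeles M := by
  have h1 : ideleIdealClass M (Units.map (NumberField.AdeleRing.baseChange E M :
      AdeleRing (𝓞 E) E →* AdeleRing (𝓞 M) M) x) = 1 := by
    rw [ideleIdealClass_baseChange, classGroupExtend_eq_one_of_algEquiv E M e]
  rw [← MonoidHom.mem_ker, ker_ideleIdealClass] at h1
  exact sup_le_sup_left rayUnitIdeles_le_unitIdeles _ h1

/-- **`I_E ⊆ Mˣ · J_{M,S}`** for any `E`-isomorphic copy `M` of `H(E)`, any base `F` of `M` and any finite `S`
(Tate's `S`-idèles contain the unit idèles). [cite: NeukirchANT1999, Ch. VI §7 Thm. (7.5)]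
[cite: CasselsFrohlichANT1967, Ch. VII (Tate) §7.3 (J_{L,S})] -/
theorem baseChange_mem_principalIdeles_sup_ideleS_of_algEquiv (e : hilbertClassField E ≃ₐ[E] M)
    (F : Type) [Field F] [NumberField F] [Algebra F M] (S : Finset (HeightOneSpectrum (𝓞 F))) (x : ideleGroup E) :
    Units.map (NumberField.AdeleRing.baseChange E M : AdeleRing (𝓞 E) E →* AdeleRing (𝓞 M) M) x ∈
      principalIdeles M ⊔ IdeleCohomology.ideleS F M S :=
  sup_le_sup_left IdeleCohomology.unitIdeles_le_ideleS _
    (baseChange_mem_principalIdeles_sup_unitIdeles_of_algEquiv E M e x)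

/-- **The (A3d) shape**: `ideleBaseChange E M x = principal M u * j` with `u ∈ Mˣ` and `j ∈ J_{M,S}`, for the TREE's
`Automorphic.AdeleRing.ideleBaseChange` (= the packet's base change on units, `adeleRing_baseChange_toRingHom_eq`) and
`IdeleHerbrand.principal`. [cite: NeukirchANT1999, Ch. VI §7 Thm. (7.5)] [cite: CasselsFrohlichANT1967, Ch. VII (Tate) §7.3] -/
theorem exists_principal_mul_ideleS_eq_ideleBaseChange_of_algEquiv (e : hilbertClassField E ≃ₐ[E] M)
    (F : Type) [Field F] [NumberField F] [Algebra F M] (S : Finset (HeightOneSpectrum (𝓞 F))) (x : ideleGroup E) :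
    ∃ u : Mˣ, ∃ j ∈ IdeleCohomology.ideleS F M S,
      Literature.NumberTheory.Automorphic.AdeleRing.ideleBaseChange E M x = IdeleHerbrand.principal M u * j := by
  have hmem := baseChange_mem_principalIdeles_sup_ideleS_of_algEquiv E M e F S x
  obtain ⟨a, ha, j, hj, haj⟩ := Subgroup.mem_sup.mp hmem
  obtain ⟨u, rfl⟩ := MonoidHom.mem_range.mp ha
  refine ⟨u, j, hj, ?_⟩
  have hbc : Literature.NumberTheory.Automorphic.AdeleRing.ideleBaseChange E M x =
      Units.map (NumberField.AdeleRing.baseChange E M : AdeleRing (𝓞 E) E →* AdeleRing (𝓞 M) M) x := by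
    apply Units.ext
    rw [Literature.NumberTheory.Automorphic.AdeleRing.coe_ideleBaseChange, Units.coe_map,
      ← adeleRing_baseChange_toRingHom_eq]
    rfl
  rw [hbc, ← haj]
  rfl

/-! ## §3. Finiteness, unramifiedness and the Galois property of the copy -/

omit [NumberField M] in
/-- The copy is finite over `E`. [cite: NeukirchANT1999, Ch. VI §6 Prop. (6.9) (H(E)/E finite)] -/
theorem finiteDimensional_of_algEquiv (e : hilbertClassField E ≃ₐ[E] M) : FiniteDimensional E M :=
  LinearEquiv.finiteDimensional e.toLinearEquiv

/-- **Every finite place of `E` is unramified in the copy `M`** (it is in `H(E)`, `hilbertClassField.isUnramifiedIn`;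
ramification indices over `ℤ` are invariant under the ring isomorphism `𝓞 H(E) ≅ 𝓞 M` induced by `e`, and `e` is
multiplicative in the towers `ℤ ⊆ 𝓞 E ⊆ 𝓞 H(E)`, `ℤ ⊆ 𝓞 E ⊆ 𝓞 M`). [cite: NeukirchANT1999, Ch. VI §6 Prop. (6.9); Ch. II §9 (multiplicativity of e)] -/
theorem isUnramifiedIn_of_algEquiv (e : hilbertClassField E ≃ₐ[E] M) (w : HeightOneSpectrum (𝓞 E)) :
    Algebra.IsUnramifiedIn (𝓞 M) w.asIdeal := by
  -- adapted from the tree's private `forall_isUnramifiedIn_of_ringEquiv_twist`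
  -- (`HilbertClassFieldOfGaloisExtension.lean`, hodge lane), with the twist `σ = 1`
  classical
  intro Q hQ hQv
  haveI := hQ
  have hQ0 : Q ≠ ⊥ := by
    intro h0
    apply w.ne_bot
    rw [hQv.over, h0, Ideal.under_def, Ideal.comap_bot_of_injective _
      (FaithfulSMul.algebraMap_injective (𝓞 E) (𝓞 M))]
  haveI : Q.IsMaximal := hQ.isMaximal hQ0
  set A := hilbertClassField E
  -- the ring isomorphism of integers and its compatibility with `𝓞 E`
  set eO : 𝓞 A ≃+* 𝓞 M := RingOfIntegers.mapRingEquiv (e : A ≃+* M) with heO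
  have hcompat : (eO : 𝓞 A →+* 𝓞 M).comp (algebraMap (𝓞 E) (𝓞 A)) = algebraMap (𝓞 E) (𝓞 M) := by
    ext x
    change ((eO (algebraMap (𝓞 E) (𝓞 A) x) : 𝓞 M) : M) = ((algebraMap (𝓞 E) (𝓞 M) x : 𝓞 M) : M)
    rw [heO, RingOfIntegers.mapRingEquiv_apply]
    change (e : A ≃+* M) (algebraMap E A (x : E)) = algebraMap E M (x : E)
    exact e.commutes (x : E)
  -- `P = e⁻¹ Q` and the primes below it
  set P : Ideal (𝓞 A) := Q.comap (eO : 𝓞 A →+* 𝓞 M) with hPdef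
  haveI : P.IsMaximal := Ideal.comap_isMaximal_of_surjective _ eO.surjective
  have hPL : P.under (𝓞 E) = Q.under (𝓞 E) := by
    rw [Ideal.under_def, Ideal.under_def, hPdef, Ideal.comap_comap, hcompat]
  have hQZ0 : Q.under ℤ ≠ ⊥ := mt Ideal.eq_bot_of_comap_eq_bot hQ0
  -- ramification indices over `ℤ` are preserved by `eO`
  have e1 : P.ramificationIdx ℤ = Q.ramificationIdx ℤ := by
    let e' : 𝓞 A ≃ₐ[ℤ] 𝓞 M := AlgEquiv.ofRingEquiv (f := eO) fun n => by simp
    have hcomap : Q.comap (eO : 𝓞 A →+* 𝓞 M) = Q.comap e' := rfl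
    haveI : (Q.comap (eO : 𝓞 A →+* 𝓞 M)).LiesOver (Q.under ℤ) := ⟨by
      rw [Ideal.under_def, Ideal.under_def, Ideal.comap_comap]
      congr 1
      ext n
      simp⟩
    haveI : Module.IsTorsionFree ℤ (𝓞 A) := inferInstance
    haveI : Module.IsTorsionFree ℤ (𝓞 M) := inferInstance
    rw [hPdef, ← Ideal.ramificationIdx'_eq_ramificationIdx (Q.under ℤ) Q hQZ0,
      ← Ideal.ramificationIdx'_eq_ramificationIdx (Q.under ℤ) (Q.comap (eO : 𝓞 A →+* 𝓞 M)) hQZ0, hcomap]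
    exact Ideal.ramificationIdx'_comap_eq (Q.under ℤ) e' Q
  -- towers `ℤ ⊆ 𝓞 E ⊆ 𝓞 A` and `ℤ ⊆ 𝓞 E ⊆ 𝓞 M`
  haveI : P.LiesOver (P.under (𝓞 E)) := ⟨rfl⟩
  haveI : Q.LiesOver (Q.under (𝓞 E)) := ⟨rfl⟩
  haveI : (Q.under (𝓞 E)).IsMaximal := Ideal.IsMaximal.under (𝓞 E) Q
  have tA : P.ramificationIdx ℤ = (P.under (𝓞 E)).ramificationIdx ℤ * P.ramificationIdx (𝓞 E) :=
    Ideal.ramificationIdx_tower (P.under (𝓞 E)) P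
  have tB : Q.ramificationIdx ℤ = (Q.under (𝓞 E)).ramificationIdx ℤ * Q.ramificationIdx (𝓞 E) :=
    Ideal.ramificationIdx_tower (Q.under (𝓞 E)) Q
  -- `P` is unramified over `E` (it lies over `w`)
  have hP0 : P ≠ ⊥ := fun h0 => hQ0 (by
    rw [hPdef] at h0
    exact (Ideal.comap_injective_of_surjective _ eO.surjective) (h0.trans
      (Ideal.comap_bot_of_injective _ eO.injective).symm))
  haveI : (P.under (𝓞 E)).IsMaximal := Ideal.IsMaximal.under (𝓞 E) P
  haveI hPw : P.LiesOver w.asIdeal := ⟨by rw [hPL]; exact hQv.over⟩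
  haveI : Algebra.IsUnramifiedAt (𝓞 E) P := hilbertClassField.isUnramifiedIn E w P inferInstance hPw
  rw [Ideal.ramificationIdx_eq_one P (𝓞 E), mul_one, e1, hPL] at tA
  rw [tA] at tB
  have hpos : 0 < (Q.under (𝓞 E)).ramificationIdx ℤ := Ideal.ramificationIdx_pos _ _
  have hQ1 : Q.ramificationIdx (𝓞 E) = 1 :=
    Nat.eq_of_mul_eq_mul_left hpos (tB.symm.trans (mul_one _).symm)
  exact (Ideal.ramificationIdx_eq_one_iff).mp hQ1

omit [NumberField M] in
/-- **The copy is Galois over any `F` over which `E` is Galois** (`H(E)/F` is Galois — Washington, proof of Thm. 10.4;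
tree `hilbertClassField.isGalois_of_isGalois` — transported along the `F`-linear `e`). [cite: Washington1997, Thm. 10.4 (proof)] -/
theorem isGalois_of_algEquiv (e : hilbertClassField E ≃ₐ[E] M) (F : Type) [Field F] [Algebra F E] [Algebra F M]
    [IsScalarTower F E M] [IsGalois F E] : IsGalois F M := by
  haveI : IsGalois F (hilbertClassField E) := hilbertClassField.isGalois_of_isGalois E
  exact IsGalois.of_algEquiv (e.restrictScalars F)

end hilbertClassField

end Literature.NumberTheory.NumberFields

end
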